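import Summits.QuantumFields.YangMills.Theorems.BalabanUVNodesN15TwoGridEntry2ForwardL2
import HarnessLib

/-!
# N15 (NE2) — Bałaban's full propagator pair, part N-IIq: ★★★ THE FORWARD RIGHT ENTRY `𝔇(G∂_ν)` IN SUP-BLOCK CURRENCY, HYPOTHESIS-FREE (`hSrc` AS A THEOREM)

WHO ∕ WHEN.  Cell `pub-ymgap`, seat `pub-ymgap-dag-n15-a` (g22); `--supports stmt-QuantumFields-27366 --as helper` (count-neutral).  Sequel of N-IIp
(`…TwoGridEntry2ForwardL2`: the forward entry in (sup → L²-block) currency); feeds N-IIr (`…NeumannCubeRightEntriesDefectClosed`: (c)⁺ binder-free) and dag-n15-c g13's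
displayed `hSrc` letter of `𝔇(R̃′, R̃)` BY NAME.
WHAT.  §6 ★ `hasMaj_gradStepsFwd_of_ineq` (one torus: the `j`-step (1.111) oscillation of `G∘∇_ν`, `4j ≤ n` — part 66 `hasMaj_divSteps_of_ineq` read one source step ahead,
`∇_ν = −∇̃*_ν∘S_ν`, N-IIp's `hasMaj_comp_fshift_pow`; cost `2e^{δ₀}`).  §7 ★ `hasMaj_osc_entry2_fwd` (the `t`-step oscillations of `𝔇(G∂_ν)`, `t < ℓ`, `4ℓ ≤ n′`, `L^m ≤ ℓ`:
§113's proof with §6 in place of part 66), `hasMaj_entry2_fwd_apriori` (`4Ce^{δ₀}·e^{−δ₀d}`, from N-IIn's `hasMaj_gGrad_of_ineq` on both members).  §8 ★★★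
**`hasMaj_twoGridDefect_grad_fwd`**: for odd `L ≥ 3`, `a > 0`: `∃ δ C > 0 ∀ m_T, k ≥ 1, m, ν`,
`HasMaj (ofBlocks blkFine) (ofBlocks blockOf′) (idef P P (G′∘ρ′(sD′_ν n′)) (G∘ρ(sD_ν n))) (C·(L^k)^{−1∕(8(d+1))}·e^{−δ|y−y′|_T})` — LITERALLY the hypothesis `hSrc` of N-IIo's
`hasMaj_idef_rightGrad_of_torusDefect`; §114's interpolation (part 70 `hasMaj_sup_of_l2Blocks_osc`, sub-boxes of side `L^m·L^{k−⌊k∕4(d+1)⌋}`) fed with N-IIp (`γ = 1∕2`) and §7;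
`k < 8(d+1)` by the a-priori bound.
HONEST FRAMING ∕ LIMITS.  Lattice algebra + block-majorant bookkeeping over LANDED rows ((1.110)∕(1.111)∕(1.114) via `ineq110_114_pair`; parts 66, 69, 70; N-IIn, N-IIp); no new
analytic estimate; `U ≡ 1` torus MODEL of [B5] §1 (the rate `1∕(8(d+1))` is what this sup-only-readable currency affords); nothing of [B6] (2.38)–(2.40)∕[B9] asserted; N15 NOT
discharged (object-bound; NE2⁺ NOT PRINTED); counts UNMOVED (typed 28∕28 · discharged 5∕27); one finite torus pair per index — NOT continuum ∕ ℝ⁴ ∕ OS ∕ mass gap ∕ Clay.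
Theorems only (0 `def`).
-/

open scoped BigOperators
open Finset

namespace Summit.QuantumFields.YangMills.BalabanUVNodes.N15.TwoGrid

open Literature.MathematicalPhysics.QuantumFieldTheory.Balaban1983to89
open Literature.MathematicalPhysics.QuantumFieldTheory.Balaban1983to89.B11SectG (BlockNorm HasMaj)
open Literature.MathematicalPhysics.QuantumFieldTheory.Balaban1983to89.T4EtaRateDefect (idef)
open Literature.MathematicalPhysics.QuantumFieldTheory.Balaban1983to89.T4EtaRateCoeffDefect (pull pull_apply)
open Literature.MathematicalPhysics.QuantumFieldTheory.Balaban1983to89.B5Prop11Plancherel (Tor fine unitVec)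
open Literature.MathematicalPhysics.QuantumFieldTheory.Balaban1983to89.B5SettingP12Real (latticeSettingP12R)
open Literature.MathematicalPhysics.QuantumFieldTheory.Balaban1983to89.B5SettingP12Weighted (etaPow etaPow_nonneg)
open Literature.MathematicalPhysics.QuantumFieldTheory.Balaban1983to89.B5SiteBridgeP12 (MP)
open Literature.MathematicalPhysics.QuantumFieldTheory.Balaban1983to89.B5CoverP12Lattice (Lθ Lθ_nonneg)
open Literature.MathematicalPhysics.QuantumFieldTheory.King1986.Torus (blockOf tdistT tdistT_nonneg tdistT_symm)
open Literature.MathematicalPhysics.QuantumFieldTheory.Balaban1983to89.B6UnitTorusCarrier (unitTorusGeo)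
open Summit.QuantumFields.YangMills.BalabanUVNodes.N15.VectorPiece (blkFine kingPrV blkFine_comp_kingPrV)

variable {d : ℕ}

/-! ## §6 ★ The multi-step oscillations of the forward right entry `G∘∇_ν` on one torus -/

section Steps

variable {L : ℕ} {k : ℕ} (M : Fin (d + 1) → ℕ) [∀ μ, NeZero (M μ)] (n : ℕ) [NeZero n] (a : ℝ)

/-- ★ **`j`-STEP OSCILLATIONS OF `G∘∇_ν`**, `4j ≤ n`: `(ρ(s_κ^j) − 1)∘G∘ρ(sD_ν n) ≤ 2e^{δ₀}·|C_α|(Lθ+1)e^{δ₀}·(j∕n)^α·e^{−δ₀d}` — part 66 (`hasMaj_divSteps_of_ineq`, the (1.111)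
oscillation of «G∇*») read one source step ahead (`∇_ν = −∇̃*_ν∘S_ν`, `hasMaj_comp_fshift_pow`). [cite: Balaban1984PropagatorsI, Prop. 1.2 (1.111) p.35, (1.3) p.18] -/
theorem hasMaj_gradStepsFwd_of_ineq (hM2 : ∀ μ, 2 ≤ M μ) {j : ℕ} (hj : 4 * j ≤ n) {K : ℕ} {C δ₀ : ℝ} {Cα Cε : ℝ → ℝ} {Cαε : ℝ → ℝ → ℝ}
    (H : B5.Ineq110_114 (latticeSettingP12R n M a K) C Cα Cε Cαε δ₀) (hδ₀ : 0 ≤ δ₀) {α : ℝ} (hα0 : 0 ≤ α) (hα1 : α < 1)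
    (κ ν : Fin (d + 1)) :
    HasMaj (BlockNorm.ofBlocks (unitTorusGeo L k M) (fun i : Tor (fine n M) × Fin (d + 1) => blockOf n M i.1))
      (BlockNorm.ofBlocks (unitTorusGeo L k M) (fun i : Tor (fine n M) × Fin (d + 1) => blockOf n M i.1))
      (symbOp M n (sT M n κ ^ j - 1) ∘ₗ gOp M n a ∘ₗ symbOp M n (sD M n ν (n : ℝ)))
      (fun y y' => 2 * (|Cα α| * (Lθ (d + 1) + 1) * Real.exp δ₀ * ((j : ℝ) / n) ^ α * Real.exp δ₀) * Real.exp (-(δ₀ * tdistT M y y'))) := by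
  have hn1 : 1 ≤ n := Nat.one_le_iff_ne_zero.mpr (NeZero.ne n)
  have hsD : symbOp M n (sD M n ν (n : ℝ)) = -(symbOp M n ((n : ℝ) • (sTinv M n ν - 1)) ∘ₗ symbOp M n (sT M n ν ^ 1)) := by
    rw [sD_eq_neg_sDbar_mul_sT, map_neg, map_mul, Module.End.mul_eq_comp]
  have h0 := hasMaj_divSteps_of_ineq (L := L) (k := k) M n a hM2 hj H hδ₀ hα0 hα1 κ ν
  have hB0 : 0 ≤ |Cα α| * (Lθ (d + 1) + 1) * Real.exp δ₀ * ((j : ℝ) / n) ^ α :=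
    mul_nonneg (mul_nonneg (mul_nonneg (abs_nonneg _) (by linarith [Lθ_nonneg (d + 1)])) (Real.exp_nonneg _))
      (Real.rpow_nonneg (div_nonneg (Nat.cast_nonneg j) (Nat.cast_nonneg n)) _)
  have h1 : HasMaj (BlockNorm.ofBlocks (unitTorusGeo L k M) (fun i : Tor (fine n M) × Fin (d + 1) => blockOf n M i.1))
      (BlockNorm.ofBlocks (unitTorusGeo L k M) (fun i : Tor (fine n M) × Fin (d + 1) => blockOf n M i.1))
      ((symbOp M n (sT M n κ ^ j - 1) ∘ₗ gOp M n a ∘ₗ symbOp M n ((n : ℝ) • (sTinv M n ν - 1))) ∘ₗ symbOp M n (sT M n ν ^ 1))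
      (fun y y' => 2 * (|Cα α| * (Lθ (d + 1) + 1) * Real.exp δ₀ * ((j : ℝ) / n) ^ α * Real.exp δ₀) * Real.exp (-(δ₀ * tdistT M y y'))) :=
    hasMaj_comp_fshift_pow (L := L) (k := k) M n hB0 hδ₀ ν hn1 h0
  rw [hsD]
  refine h1.neg.congr fun f => ?_
  simp only [LinearMap.neg_apply, LinearMap.comp_apply, map_neg]

end Steps

/-! ## §7 ★ The multi-step oscillations and the a-priori bound of `𝔇(G∂_ν)` -/

section Osc

variable {L : ℕ} [NeZero L] (M : Fin (d + 1) → ℕ) [∀ μ, NeZero (M μ)] (k m : ℕ) (a : ℝ)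

/-- ★ **`t`-STEP OSCILLATIONS OF `𝔇(G∂_ν) = G′∂′_νP − PG∂_ν`**, `t < ℓ`, `4ℓ ≤ n′`, `L^m ≤ ℓ`, `M_μ ≥ 2`: sup majorant `2e^{δ₀}·|C_α|(Lθ+1)e^{δ₀}·(2 + e^{δ₀})·(ℓ∕n′)^α·e^{−δ₀d}`
— §113 (`hasMaj_osc_entry2`) with §6 in place of part 66. [cite: Balaban1984PropagatorsI, Prop. 1.2 (1.111) p.35; King1986, p.664 (pairing convention)] -/
theorem hasMaj_osc_entry2_fwd (hM2 : ∀ μ, 2 ≤ M μ) {K K' : ℕ} {C₀ δ₀ : ℝ} {Cα Cε : ℝ → ℝ} {Cαε : ℝ → ℝ → ℝ} (hδ₀ : 0 ≤ δ₀)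
    (HP : B5.Ineq110_114 (latticeSettingP12R (L ^ k) M a K) C₀ Cα Cε Cαε δ₀)
    (HP' : B5.Ineq110_114 (latticeSettingP12R (L ^ m * L ^ k) M a K') C₀ Cα Cε Cαε δ₀) {α : ℝ} (hα0 : 0 ≤ α) (hα1 : α < 1)
    {ℓ : ℕ} (h4ℓ : 4 * ℓ ≤ L ^ m * L ^ k) (hmℓ : L ^ m ≤ ℓ) (ν i : Fin (d + 1)) {t : ℕ} (ht : t < ℓ) :
    HasMaj (BlockNorm.ofBlocks (unitTorusGeo L k M) (blkFine L k M))
      (BlockNorm.ofBlocks (unitTorusGeo L k M) (fun z : Tor (fine (L ^ m * L ^ k) M) × Fin (d + 1) => blockOf (L ^ m * L ^ k) M z.1))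
      (symbOp M (L ^ m * L ^ k) (sT M (L ^ m * L ^ k) i ^ t - 1) ∘ₗ
        idef (pull (kingPrV L k m M)) (pull (kingPrV L k m M))
          (gOp M (L ^ m * L ^ k) a ∘ₗ symbOp M (L ^ m * L ^ k) (sD M (L ^ m * L ^ k) ν ((L ^ m * L ^ k : ℕ) : ℝ)))
          (gOp M (L ^ k) a ∘ₗ symbOp M (L ^ k) (sD M (L ^ k) ν ((L ^ k : ℕ) : ℝ))))
      (fun y y' => 2 * Real.exp δ₀ * (|Cα α| * (Lθ (d + 1) + 1) * Real.exp δ₀) * (2 + Real.exp δ₀) * ((ℓ : ℝ) / ((L ^ m * L ^ k : ℕ) : ℝ)) ^ α *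
        Real.exp (-(δ₀ * tdistT M y y'))) := by
  classical
  haveI : NeZero (L ^ k) := ⟨pow_ne_zero k (NeZero.ne L)⟩
  haveI : NeZero (L ^ m * L ^ k) := ⟨Nat.mul_ne_zero (pow_ne_zero m (NeZero.ne L)) (pow_ne_zero k (NeZero.ne L))⟩
  have hL0 : 0 < L := Nat.pos_of_ne_zero (NeZero.ne L)
  have hR0 : L ^ m ≠ 0 := pow_ne_zero m (NeZero.ne L)
  have hR1 : 1 ≤ L ^ m := Nat.one_le_pow _ _ hL0
  have hn1 : 1 ≤ L ^ k := Nat.one_le_pow _ _ hL0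
  have hn0 : (0 : ℝ) < ((L ^ k : ℕ) : ℝ) := by exact_mod_cast hn1
  have hn'0 : (0 : ℝ) < ((L ^ m * L ^ k : ℕ) : ℝ) := by exact_mod_cast (NeZero.ne (L ^ m * L ^ k) |> Nat.pos_of_ne_zero)
  obtain ⟨C₁, hC₁⟩ : ∃ C₁ : ℝ, C₁ = 2 * Real.exp δ₀ * (|Cα α| * (Lθ (d + 1) + 1) * Real.exp δ₀) := ⟨_, rfl⟩
  have hC₁0 : 0 ≤ C₁ := by
    rw [hC₁]; exact mul_nonneg (by positivity) (mul_nonneg (mul_nonneg (abs_nonneg _) (by linarith [Lθ_nonneg (d + 1)])) (Real.exp_nonneg _))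
  obtain ⟨s, hs⟩ : ∃ s : ℝ, s = ((ℓ : ℝ) / ((L ^ m * L ^ k : ℕ) : ℝ)) ^ α := ⟨_, rfl⟩
  have hℓn' : 0 ≤ (ℓ : ℝ) / ((L ^ m * L ^ k : ℕ) : ℝ) := div_nonneg (Nat.cast_nonneg ℓ) hn'0.le
  have hs0 : 0 ≤ s := by rw [hs]; exact Real.rpow_nonneg hℓn' _
  have hn4 : 4 * 1 ≤ L ^ k := by
    have h' : L ^ m * 4 ≤ L ^ m * L ^ k := by nlinarith [h4ℓ, hmℓ]
    simpa using Nat.le_of_mul_le_mul_left h' (Nat.pos_of_ne_zero hR0)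
  have hE : ∀ y y' : Tor M, 0 ≤ Real.exp (-(δ₀ * tdistT M y y')) := fun _ _ => Real.exp_nonneg _
  -- the rescaling of §6's constant: `2·(|C_α|(Lθ+1)e^{δ₀}·x^α·e^{δ₀}) = C₁·x^α`
  have hresc : ∀ x : ℝ, 2 * (|Cα α| * (Lθ (d + 1) + 1) * Real.exp δ₀ * x * Real.exp δ₀) = C₁ * x := fun x => by rw [hC₁]; ring
  set bC := BlockNorm.ofBlocks (unitTorusGeo L k M) (blkFine L k M) with hbC
  set bF := BlockNorm.ofBlocks (unitTorusGeo L k M) (fun z : Tor (fine (L ^ m * L ^ k) M) × Fin (d + 1) => blockOf (L ^ m * L ^ k) M z.1) with hbF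
  set P := pull (kingPrV L k m M) with hP
  set Y := gOp M (L ^ k) a ∘ₗ symbOp M (L ^ k) (sD M (L ^ k) ν ((L ^ k : ℕ) : ℝ)) with hY
  set Y' := gOp M (L ^ m * L ^ k) a ∘ₗ symbOp M (L ^ m * L ^ k) (sD M (L ^ m * L ^ k) ν ((L ^ m * L ^ k : ℕ) : ℝ)) with hY'
  have ht4 : 4 * t ≤ L ^ m * L ^ k := by omega
  -- (A) the fine oscillation of `G′∂′` through `P` on the source side
  have hA0 := hasMaj_gradStepsFwd_of_ineq (L := L) (k := k) M (L ^ m * L ^ k) a hM2 ht4 HP' hδ₀ hα0 hα1 i ν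
  have hts : C₁ * ((t : ℝ) / ((L ^ m * L ^ k : ℕ) : ℝ)) ^ α ≤ C₁ * s := by
    rw [hs]
    exact mul_le_mul_of_nonneg_left (Real.rpow_le_rpow (div_nonneg (Nat.cast_nonneg t) hn'0.le) (div_le_div_of_nonneg_right (by exact_mod_cast ht.le) hn'0.le) hα0) hC₁0
  have hA : HasMaj bC bF (symbOp M (L ^ m * L ^ k) (sT M (L ^ m * L ^ k) i ^ t - 1) ∘ₗ (Y' ∘ₗ P)) (fun y y' => C₁ * s * Real.exp (-(δ₀ * tdistT M y y'))) := by
    have hA1 := hA0.mono fun y y' => le_of_eq (congrArg (· * Real.exp (-(δ₀ * tdistT M y y'))) (hresc (((t : ℝ) / ((L ^ m * L ^ k : ℕ) : ℝ)) ^ α)))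
    have h := hasMaj_comp_pull_kingPrV M k m (fun y y' => mul_nonneg (mul_nonneg hC₁0
      (Real.rpow_nonneg (div_nonneg (Nat.cast_nonneg t) hn'0.le) _)) (hE y y')) hA1
    rw [← LinearMap.comp_assoc]
    exact (h.congr fun f => rfl).mono fun y y' => mul_le_mul_of_nonneg_right hts (hE y y')
  -- (B) the coarse member: `t = L^m q + i'`
  obtain ⟨q, hq⟩ : ∃ q : ℕ, q = t / L ^ m := ⟨_, rfl⟩
  obtain ⟨i', hi'⟩ : ∃ i' : ℕ, i' = t % L ^ m := ⟨_, rfl⟩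
  have hqi : L ^ m * q + i' = t := by rw [hq, hi']; exact Nat.div_add_mod t (L ^ m)
  have hiR : i' ≤ L ^ m := by rw [hi']; exact (Nat.mod_lt t (Nat.pos_of_ne_zero hR0)).le
  have hq4 : 4 * q ≤ L ^ k := by rw [hq]; exact four_mul_div_le hR0 ht4
  have hRqt : L ^ m * q ≤ t := by rw [hq]; exact Nat.mul_div_le t (L ^ m)
  have hRq : L ^ m * q ≤ L ^ m * L ^ k := by omega
  have hsplit := shiftSub_X_pull_split M k m i q i' (1 : AddMonoidAlgebra ℝ (Tor (fine (L ^ m * L ^ k) M))) Y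
  rw [hqi, map_one, Module.End.one_eq_id, LinearMap.id_comp, LinearMap.id_comp, LinearMap.id_comp] at hsplit
  -- the one-step majorant of `η∇_iY` (§6, `j = 1`) and the `q`-step one
  have hstep : HasMaj bC bC ((((L ^ k : ℕ) : ℝ)⁻¹ • symbOp M (L ^ k) (sD M (L ^ k) i ((L ^ k : ℕ) : ℝ))) ∘ₗ Y) (fun y y' => C₁ * s * Real.exp (-(δ₀ * tdistT M y y'))) := by
    rw [inv_smul_symbOp_sD M (L ^ k) i hn0.ne']
    have h := hasMaj_gradStepsFwd_of_ineq (L := L) (k := k) M (L ^ k) a hM2 (j := 1) hn4 HP hδ₀ hα0 hα1 i ν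
    have h1s : C₁ * (((1 : ℕ) : ℝ) / ((L ^ k : ℕ) : ℝ)) ^ α ≤ C₁ * s := by
      rw [hs]
      refine mul_le_mul_of_nonneg_left (Real.rpow_le_rpow (div_nonneg (by positivity) hn0.le) ?_ hα0) hC₁0
      rw [Nat.cast_one, div_le_div_iff₀ hn0 hn'0, one_mul, Nat.cast_mul]
      have : ((L ^ m : ℕ) : ℝ) ≤ (ℓ : ℝ) := by exact_mod_cast hmℓ
      nlinarith
    rw [hY]
    exact h.mono fun y y' => by rw [hresc]; exact mul_le_mul_of_nonneg_right h1s (hE y y')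
  have hB1 : HasMaj bC bF (symbOp M (L ^ m * L ^ k) (sT M (L ^ m * L ^ k) i ^ (L ^ m * q)) ∘ₗ ((symbOp M (L ^ m * L ^ k) (sT M (L ^ m * L ^ k) i ^ i') ∘ₗ P - P) ∘ₗ Y))
      (fun y y' => C₁ * s * Real.exp δ₀ * Real.exp (-(δ₀ * tdistT M y y'))) :=
    hasMaj_sT_pow_comp M k (L ^ m * L ^ k) (mul_nonneg hC₁0 hs0) hδ₀ i hRq (hasMaj_shiftPull_sub M k m (fun y y' => mul_nonneg (mul_nonneg hC₁0 hs0) (hE y y')) i hiR hstep)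
  have hB2 : HasMaj bC bF (P ∘ₗ (symbOp M (L ^ k) (sT M (L ^ k) i ^ q - 1) ∘ₗ Y)) (fun y y' => C₁ * s * Real.exp (-(δ₀ * tdistT M y y'))) := by
    have hc0 := hasMaj_gradStepsFwd_of_ineq (L := L) (k := k) M (L ^ k) a hM2 hq4 HP hδ₀ hα0 hα1 i ν
    have hqn0 : 0 ≤ (q : ℝ) / ((L ^ k : ℕ) : ℝ) := div_nonneg (Nat.cast_nonneg q) hn0.le
    have hqs : C₁ * ((q : ℝ) / ((L ^ k : ℕ) : ℝ)) ^ α ≤ C₁ * s := by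
      rw [hs]
      refine mul_le_mul_of_nonneg_left (Real.rpow_le_rpow hqn0 ?_ hα0) hC₁0
      rw [div_le_div_iff₀ hn0 hn'0, Nat.cast_mul]
      have h1 : ((L ^ m : ℕ) : ℝ) * (q : ℝ) ≤ (t : ℝ) := by exact_mod_cast hRqt
      have h2 : (t : ℝ) ≤ (ℓ : ℝ) := by exact_mod_cast ht.le
      have h3 : (0 : ℝ) ≤ ((L ^ k : ℕ) : ℝ) := hn0.le
      nlinarith
    have hc : HasMaj bC bC ((symbOp M (L ^ k) (sT M (L ^ k) i ^ q - 1) ∘ₗ Y)) (fun y y' => C₁ * s * Real.exp (-(δ₀ * tdistT M y y'))) := by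
      rw [hY]
      exact hc0.mono fun y y' => by rw [hresc]; exact mul_le_mul_of_nonneg_right hqs (hE y y')
    have hK0 : ∀ y y' : Tor M, 0 ≤ C₁ * s * Real.exp (-(δ₀ * tdistT M y y')) := fun y y' => mul_nonneg (mul_nonneg hC₁0 hs0) (hE y y')
    exact hasMaj_pull_comp₂ (g := unitTorusGeo L k M) (b₁ := bC) (blkFine L k M)
      (fun z : Tor (fine (L ^ m * L ^ k) M) × Fin (d + 1) => blockOf (L ^ m * L ^ k) M z.1) (kingPrV L k m M) hK0
      (fun x y' => by rw [show blkFine L k M (kingPrV L k m M x) = blockOf (L ^ m * L ^ k) M x.1 from congrFun (blkFine_comp_kingPrV M L k m) x]) hc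
  -- assembly
  rw [idef, LinearMap.comp_sub, hsplit]
  refine ((hA.sub (hB1.add hB2)).congr fun f => rfl).mono fun y y' => le_of_eq ?_
  rw [hC₁, hs]; ring

/-- **THE A-PRIORI BOUND** for `𝔇(G∂_ν)` (no rate): `4Ce^{δ₀}·e^{−δ₀d}` from the torus letter of `G∘∇_ν` (`hasMaj_gGrad_of_ineq`, N-IIn) on both members.
[cite: Balaban1984PropagatorsI, Prop. 1.2 (1.110) p.35 (entry «G∇*»), (1.3) p.18] -/
theorem hasMaj_entry2_fwd_apriori (ν : Fin (d + 1)) {K K' : ℕ} {C δ₀ : ℝ} {Cα Cε : ℝ → ℝ} {Cαε : ℝ → ℝ → ℝ} (hC : 0 ≤ C) (hδ₀ : 0 ≤ δ₀)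
    (H1 : B5.Ineq110_114 (latticeSettingP12R (L ^ k) M a K) C Cα Cε Cαε δ₀) (H2 : B5.Ineq110_114 (latticeSettingP12R (L ^ m * L ^ k) M a K') C Cα Cε Cαε δ₀) :
    HasMaj (BlockNorm.ofBlocks (unitTorusGeo L k M) (blkFine L k M))
      (BlockNorm.ofBlocks (unitTorusGeo L k M) (fun z : Tor (fine (L ^ m * L ^ k) M) × Fin (d + 1) => blockOf (L ^ m * L ^ k) M z.1))
      (idef (pull (kingPrV L k m M)) (pull (kingPrV L k m M))
        (gOp M (L ^ m * L ^ k) a ∘ₗ symbOp M (L ^ m * L ^ k) (sD M (L ^ m * L ^ k) ν ((L ^ m * L ^ k : ℕ) : ℝ)))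
        (gOp M (L ^ k) a ∘ₗ symbOp M (L ^ k) (sD M (L ^ k) ν ((L ^ k : ℕ) : ℝ))))
      (fun y y' => 4 * (C * Real.exp δ₀) * Real.exp (-(δ₀ * tdistT M y y'))) := by
  classical
  haveI : NeZero (L ^ k) := ⟨pow_ne_zero k (NeZero.ne L)⟩
  haveI : NeZero (L ^ m * L ^ k) := ⟨Nat.mul_ne_zero (pow_ne_zero m (NeZero.ne L)) (pow_ne_zero k (NeZero.ne L))⟩
  have hL0 : 0 < L := Nat.pos_of_ne_zero (NeZero.ne L)
  have hn1 : 1 ≤ L ^ k := Nat.one_le_pow _ _ hL0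
  have hn'1 : 1 ≤ L ^ m * L ^ k := Nat.one_le_iff_ne_zero.mpr (NeZero.ne _)
  have hK0 : ∀ y y' : Tor M, 0 ≤ 2 * (C * Real.exp δ₀) * Real.exp (-(δ₀ * tdistT M y y')) := fun y y' => by positivity
  have hf := hasMaj_comp_pull_kingPrV M k m hK0 (hasMaj_gGrad_of_ineq (L := L) (k := k) (M := M) (n := L ^ m * L ^ k) hn'1 H2 hC hδ₀ ν)
  have hc := hasMaj_pull_comp₂ (g := unitTorusGeo L k M) (b₁ := BlockNorm.ofBlocks (unitTorusGeo L k M) (blkFine L k M)) (blkFine L k M)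
    (fun z : Tor (fine (L ^ m * L ^ k) M) × Fin (d + 1) => blockOf (L ^ m * L ^ k) M z.1) (kingPrV L k m M) hK0
    (fun x y' => by rw [show blkFine L k M (kingPrV L k m M x) = blockOf (L ^ m * L ^ k) M x.1 from congrFun (blkFine_comp_kingPrV M L k m) x])
    (hasMaj_gGrad_of_ineq (L := L) (k := k) (M := M) (n := L ^ k) hn1 H1 hC hδ₀ ν)
  rw [idef]
  exact ((hf.congr fun μ => rfl).sub hc).mono fun y y' => le_of_eq (by ring)

end Osc

/-! ## §8 ★★★ The forward right entry in sup-block currency on the η-pair of record — `hSrc` -/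

section Family

variable {L : ℕ} [NeZero L]

/-- ★★★ **THE FORWARD RIGHT ENTRY OF [B9] (3.42) FOR BAŁABAN's FULL LANDAU-GAUGE PAIR `(G′, G) = (Δ′_a⁻¹, Δ_a⁻¹)` AT `U ≡ 1`, SUP-BLOCK CURRENCY, HYPOTHESIS-FREE** — the torus
letter `hSrc` of N-IIo (`hasMaj_idef_rightGrad_of_torusDefect`) AS A THEOREM: for odd `L ≥ 3` and `a > 0` there are `δ, C > 0` such that for EVERY torus exponent `m_T`, EVERY
coarse scale `k ≥ 1`, EVERY refinement exponent `m` and every direction `ν`, `𝔇(G∂_ν) = G′∘ρ′(sD′_ν n′)∘P − P∘G∘ρ(sD_ν n)` has the block majorant `C·(L^k)^{−1∕(8(d+1))}·e^{−δ|y−y′|_T}`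
from coarse 1-forms localised in King's unit blocks (sup) to fine 1-forms observed on unit blocks (sup).  §114's interpolation (part 70 `hasMaj_sup_of_l2Blocks_osc`) fed with N-IIp's
(sup → L²) majorant `hasMajL2_twoGridDefect_grad_fwd` (`γ = 1∕2`), §7's oscillations and a-priori bound.
[cite: Balaban1985BackgroundPropagators, Thm 3.1 (3.42) p.397 (the entry G∇*); Balaban1984PropagatorsI, Prop. 1.2 (1.110)–(1.114) pp.35–36, remark p.36; King1986, Prop. 3.9 (3.73) p.665 (η-rate shape)] -/
theorem hasMaj_twoGridDefect_grad_fwd (hLodd : Odd L) (hL2 : 2 ≤ L) {a : ℝ} (ha : 0 < a) :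
    ∃ δ C : ℝ, 0 < δ ∧ 0 < C ∧ ∀ (mT k m : ℕ) (hk : 1 ≤ k) (hL : Odd L ∧ 1 < L) (ν : Fin (d + 1)),
      HasMaj (BlockNorm.ofBlocks (unitTorusGeo L k (MP (paramsOf d L mT k hL))) (blkFine L k (MP (paramsOf d L mT k hL))))
        (BlockNorm.ofBlocks (unitTorusGeo L k (MP (paramsOf d L mT k hL)))
          (fun z : Tor (fine (L ^ m * L ^ k) (MP (paramsOf d L mT k hL))) × Fin (d + 1) => blockOf (L ^ m * L ^ k) (MP (paramsOf d L mT k hL)) z.1))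
        (idef (pull (kingPrV L k m (MP (paramsOf d L mT k hL)))) (pull (kingPrV L k m (MP (paramsOf d L mT k hL))))
          (gOp (MP (paramsOf d L mT k hL)) (L ^ m * L ^ k) a ∘ₗ
            symbOp (MP (paramsOf d L mT k hL)) (L ^ m * L ^ k) (sD (MP (paramsOf d L mT k hL)) (L ^ m * L ^ k) ν ((L ^ m * L ^ k : ℕ) : ℝ)))
          (gOp (MP (paramsOf d L mT k hL)) (L ^ k) a ∘ₗ symbOp (MP (paramsOf d L mT k hL)) (L ^ k) (sD (MP (paramsOf d L mT k hL)) (L ^ k) ν ((L ^ k : ℕ) : ℝ))))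
        (fun y y' => C * ((L ^ k : ℕ) : ℝ) ^ (-(1 / (8 * ((d : ℝ) + 1)))) * Real.exp (-(δ * tdistT (MP (paramsOf d L mT k hL)) y y'))) := by
  classical
  have hL : Odd L ∧ 1 < L := ⟨hLodd, by omega⟩
  have hL0 : 0 < L := by omega
  have hLr1 : (1 : ℝ) ≤ (L : ℝ) := by exact_mod_cast (show 1 ≤ L by omega)
  have hLr0 : (0 : ℝ) < (L : ℝ) := by linarith
  obtain ⟨δ₂, C₂, hδ₂, hC₂, H2⟩ := hasMajL2_twoGridDefect_grad_fwd (d := d) hLodd hL2 ha (γ := 1 / 2) (by norm_num) (by norm_num)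
  obtain ⟨δ₅, C₀, Cα, Cε, Cαε, hδ₅, hC₀, H5⟩ := ineq110_114_pair (d := d) hL ha
  obtain ⟨δ, hδ⟩ : ∃ δ : ℝ, δ = min δ₂ δ₅ := ⟨_, rfl⟩
  have hδpos : 0 < δ := by rw [hδ]; exact lt_min hδ₂ hδ₅
  have hδ2 : δ ≤ δ₂ := by rw [hδ]; exact min_le_left _ _
  have hδ5 : δ ≤ δ₅ := by rw [hδ]; exact min_le_right _ _
  obtain ⟨C₁, hC₁⟩ : ∃ C₁ : ℝ, C₁ = 2 * Real.exp δ₅ * (|Cα (1 / 2)| * (Lθ (d + 1) + 1) * Real.exp δ₅) := ⟨_, rfl⟩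
  have hC₁0 : 0 ≤ C₁ := by
    rw [hC₁]; exact mul_nonneg (by positivity) (mul_nonneg (mul_nonneg (abs_nonneg _) (by linarith [Lθ_nonneg (d + 1)])) (Real.exp_nonneg _))
  obtain ⟨Cbig, hCbig⟩ : ∃ Cbig : ℝ, Cbig = C₂ + 2 * ((d : ℝ) + 1) * Real.exp δ ^ (d + 1) * (C₁ * (2 + Real.exp δ₅) * (L : ℝ) ^ (1 / 2 : ℝ)) + 4 * (C₀ * Real.exp δ₅) * L :=
    ⟨_, rfl⟩
  have hCbig0 : 0 ≤ Cbig := by rw [hCbig]; positivity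
  refine ⟨δ, Cbig + 1, hδpos, by positivity, fun mT k m hk hL' ν => ?_⟩
  haveI : NeZero (L ^ k) := ⟨pow_ne_zero k (by omega)⟩
  have hM2 : ∀ μ, 2 ≤ MP (paramsOf d L mT k hL') μ := fun μ => Nat.le_mul_of_pos_right 2 (pow_pos hL0 mT)
  have hn1 : 1 ≤ L ^ k := Nat.one_le_pow _ _ hL0
  have hn0 : (0 : ℝ) < ((L ^ k : ℕ) : ℝ) := by exact_mod_cast hn1
  have hnr1 : (1 : ℝ) ≤ ((L ^ k : ℕ) : ℝ) := by exact_mod_cast hn1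
  have hncast : ((L ^ k : ℕ) : ℝ) = (L : ℝ) ^ k := by push_cast; ring
  obtain ⟨r, hr⟩ : ∃ r : ℝ, r = ((L ^ k : ℕ) : ℝ) ^ (-(1 / (8 * ((d : ℝ) + 1)))) := ⟨_, rfl⟩
  have hr0 : 0 ≤ r := by rw [hr]; exact Real.rpow_nonneg hn0.le _
  have hE : ∀ y y' : Tor (MP (paramsOf d L mT k hL')), 0 ≤ Real.exp (-(δ * tdistT (MP (paramsOf d L mT k hL')) y y')) := fun _ _ => Real.exp_nonneg _
  have HP := (H5 mT k m hk).1
  have HP' := (H5 mT k m hk).2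
  by_cases hkD : 8 * (d + 1) ≤ k
  · -- sub-boxes of side `ℓ = L^m·L^{k−j₀}`, `j₀ = ⌊k∕(4(d+1))⌋ ≥ 2`
    obtain ⟨j₀, hj₀⟩ : ∃ j₀ : ℕ, j₀ = k / (4 * (d + 1)) := ⟨_, rfl⟩
    have hj₀2 : 2 ≤ j₀ := by
      rw [hj₀]; exact (Nat.le_div_iff_mul_le (by positivity)).mpr (by linarith)
    have hj₀k : j₀ ≤ k := by rw [hj₀]; exact Nat.div_le_self k (4 * (d + 1))
    have h4j : 4 * (j₀ * (d + 1)) ≤ k := by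
      have := Nat.div_mul_le_self k (4 * (d + 1))
      rw [hj₀]; nlinarith [this]
    have hklt : k < 4 * (d + 1) * (j₀ + 1) := by rw [hj₀]; exact Nat.lt_mul_div_succ k (by positivity)
    obtain ⟨ℓ, hℓ⟩ : ∃ ℓ : ℕ, ℓ = L ^ m * L ^ (k - j₀) := ⟨_, rfl⟩
    have hkj : L ^ (k - j₀) * L ^ j₀ = L ^ k := by rw [← pow_add, Nat.sub_add_cancel hj₀k]
    have hLj4 : 4 ≤ L ^ j₀ := le_trans (by nlinarith : 4 ≤ L ^ 2) (Nat.pow_le_pow_right hL0 hj₀2)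
    have hℓ1 : 1 ≤ ℓ := by rw [hℓ]; exact Nat.one_le_iff_ne_zero.mpr (Nat.mul_ne_zero (pow_ne_zero m (by omega)) (pow_ne_zero _ (by omega)))
    have hℓfac : L ^ m * L ^ k = ℓ * L ^ j₀ := by rw [hℓ, mul_assoc, hkj]
    have hℓn : ℓ ∣ L ^ m * L ^ k := ⟨L ^ j₀, hℓfac⟩
    have h4ℓ : 4 * ℓ ≤ L ^ m * L ^ k := by
      calc 4 * ℓ = L ^ m * (L ^ (k - j₀) * 4) := by rw [hℓ]; ring
        _ ≤ L ^ m * (L ^ (k - j₀) * L ^ j₀) := Nat.mul_le_mul_left _ (Nat.mul_le_mul_left _ hLj4)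
        _ = L ^ m * L ^ k := by rw [hkj]
    have hmℓ : L ^ m ≤ ℓ := by rw [hℓ]; exact Nat.le_mul_of_pos_right _ (pow_pos hL0 _)
    have hquot : (L ^ m * L ^ k) / ℓ = L ^ j₀ := by
      rw [hℓfac, Nat.mul_div_cancel_left _ (by omega)]
    -- the L²-block majorant of N-IIp and the oscillations of §7, at the common rate `δ`
    have h2 := (H2 mT k m hk hL' ν).mono fun y y' =>
      mul_le_mul_of_nonneg_left (Real.exp_le_exp.mpr (neg_le_neg (mul_le_mul_of_nonneg_right hδ2 (tdistT_nonneg _ y y'))))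
        (mul_nonneg hC₂.le (Real.rpow_nonneg hn0.le _))
    have hosc : ∀ (i : Fin (d + 1)) (t : ℕ), t < ℓ → HasMaj (BlockNorm.ofBlocks (unitTorusGeo L k (MP (paramsOf d L mT k hL'))) (blkFine L k (MP (paramsOf d L mT k hL'))))
        (BlockNorm.ofBlocks (unitTorusGeo L k (MP (paramsOf d L mT k hL'))) (fun z : Tor (fine (L ^ m * L ^ k) (MP (paramsOf d L mT k hL'))) × Fin (d + 1) => blockOf (L ^ m * L ^ k) (MP (paramsOf d L mT k hL')) z.1))
        (symbOp (MP (paramsOf d L mT k hL')) (L ^ m * L ^ k) (sT (MP (paramsOf d L mT k hL')) (L ^ m * L ^ k) i ^ t - 1) ∘ₗ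
          idef (pull (kingPrV L k m (MP (paramsOf d L mT k hL')))) (pull (kingPrV L k m (MP (paramsOf d L mT k hL'))))
            (gOp (MP (paramsOf d L mT k hL')) (L ^ m * L ^ k) a ∘ₗ symbOp (MP (paramsOf d L mT k hL')) (L ^ m * L ^ k) (sD (MP (paramsOf d L mT k hL')) (L ^ m * L ^ k) ν ((L ^ m * L ^ k : ℕ) : ℝ)))
            (gOp (MP (paramsOf d L mT k hL')) (L ^ k) a ∘ₗ symbOp (MP (paramsOf d L mT k hL')) (L ^ k) (sD (MP (paramsOf d L mT k hL')) (L ^ k) ν ((L ^ k : ℕ) : ℝ))))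
        (fun y y' => C₁ * (2 + Real.exp δ₅) * ((ℓ : ℝ) / ((L ^ m * L ^ k : ℕ) : ℝ)) ^ (1 / 2 : ℝ) * Real.exp (-(δ * tdistT (MP (paramsOf d L mT k hL')) y y'))) := by
      intro i t ht
      have h := hasMaj_osc_entry2_fwd (L := L) (MP (paramsOf d L mT k hL')) k m a hM2 hδ₅.le HP HP' (α := 1 / 2) (by norm_num) (by norm_num) h4ℓ hmℓ ν i ht
      refine h.mono fun y y' => ?_
      rw [← hC₁]
      exact mul_le_mul_of_nonneg_left (Real.exp_le_exp.mpr (neg_le_neg (mul_le_mul_of_nonneg_right hδ5 (tdistT_nonneg _ y y'))))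
        (mul_nonneg (mul_nonneg hC₁0 (by positivity)) (Real.rpow_nonneg (div_nonneg (Nat.cast_nonneg _) (Nat.cast_nonneg _)) _))
    have hmain := hasMaj_sup_of_l2Blocks_osc (MP (paramsOf d L mT k hL')) k (L ^ m * L ^ k) hℓ1 hℓn (B₂ := C₂ * ((L ^ k : ℕ) : ℝ) ^ (-((1 : ℝ) / 2 / 2)))
      (Bosc := C₁ * (2 + Real.exp δ₅) * ((ℓ : ℝ) / ((L ^ m * L ^ k : ℕ) : ℝ)) ^ (1 / 2 : ℝ))
      (mul_nonneg (mul_nonneg hC₁0 (by positivity)) (Real.rpow_nonneg (div_nonneg (Nat.cast_nonneg _) (Nat.cast_nonneg _)) _)) hδpos.le h2 hosc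
    refine hmain.mono fun y y' => mul_le_mul_of_nonneg_right ?_ (hE y y')
    -- rate bookkeeping
    rw [hquot, ← hr]
    have hsq : Real.sqrt ((((L ^ j₀ : ℕ) : ℝ)) ^ (d + 1)) = Real.sqrt ((L : ℝ) ^ (j₀ * (d + 1))) := by
      push_cast; rw [← pow_mul]
    have h1 : Real.sqrt ((((L ^ j₀ : ℕ) : ℝ)) ^ (d + 1)) * (C₂ * ((L ^ k : ℕ) : ℝ) ^ (-((1 : ℝ) / 2 / 2))) ≤ C₂ * r := by
      rw [hsq, hncast, show (-((1 : ℝ) / 2 / 2)) = -(1 / 4 : ℝ) by norm_num, mul_left_comm]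
      refine mul_le_mul_of_nonneg_left ((sqrt_pow_mul_rpow_le hLr1 h4j).trans ?_) hC₂.le
      rw [hr, hncast]
      exact Real.rpow_le_rpow_of_exponent_le (one_le_pow₀ hLr1) (by
        rw [neg_le_neg_iff, one_div_le_one_div (by positivity) (by norm_num)]; have : (0 : ℝ) ≤ d := Nat.cast_nonneg d; nlinarith)
    have h2' : ((ℓ : ℝ) / ((L ^ m * L ^ k : ℕ) : ℝ)) ^ (1 / 2 : ℝ) ≤ (L : ℝ) ^ (1 / 2 : ℝ) * r := by
      have e : (ℓ : ℝ) / ((L ^ m * L ^ k : ℕ) : ℝ) = ((L : ℝ) ^ j₀)⁻¹ := by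
        have hℓ0 : (ℓ : ℝ) ≠ 0 := by exact_mod_cast (by omega : ℓ ≠ 0)
        rw [hℓfac]
        push_cast
        rw [← div_div, div_self hℓ0, one_div]
      rw [e, hr, hncast, show (1 / (8 * ((d : ℝ) + 1))) = 1 / (2 * (((4 * (d + 1) : ℕ) : ℝ))) by push_cast; ring]
      exact pow_rpow_neg_half_le hLr1 (by positivity) hklt
    calc Real.sqrt ((((L ^ j₀ : ℕ) : ℝ)) ^ (d + 1)) * (C₂ * ((L ^ k : ℕ) : ℝ) ^ (-((1 : ℝ) / 2 / 2)))
          + 2 * ((d : ℝ) + 1) * Real.exp δ ^ (d + 1) * (C₁ * (2 + Real.exp δ₅) * ((ℓ : ℝ) / ((L ^ m * L ^ k : ℕ) : ℝ)) ^ (1 / 2 : ℝ))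
        ≤ C₂ * r + 2 * ((d : ℝ) + 1) * Real.exp δ ^ (d + 1) * (C₁ * (2 + Real.exp δ₅) * ((L : ℝ) ^ (1 / 2 : ℝ) * r)) := by
          gcongr
      _ = (Cbig - 4 * (C₀ * Real.exp δ₅) * L) * r := by rw [hCbig]; ring
      _ ≤ (Cbig + 1) * r := by
          have h4 : 0 ≤ 4 * (C₀ * Real.exp δ₅) * L := by positivity
          exact mul_le_mul_of_nonneg_right (by linarith) hr0
  · -- `k < 8D`: the a-priori bound, `1 ≤ L·r`
    have hap := hasMaj_entry2_fwd_apriori (L := L) (MP (paramsOf d L mT k hL')) k m a ν hC₀.le hδ₅.le HP HP'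
    have hLr : 1 ≤ (L : ℝ) * r := by
      rw [hr, hncast, ← Real.rpow_natCast (L : ℝ) k, ← Real.rpow_mul hLr0.le]
      have e : (L : ℝ) * (L : ℝ) ^ ((k : ℝ) * -(1 / (8 * ((d : ℝ) + 1)))) = (L : ℝ) ^ (1 + (k : ℝ) * -(1 / (8 * ((d : ℝ) + 1)))) := by
        rw [Real.rpow_add hLr0, Real.rpow_one]
      rw [e]
      refine Real.one_le_rpow hLr1 ?_
      have hk8 : (k : ℝ) < 8 * ((d : ℝ) + 1) := by
        have : ((k : ℕ) : ℝ) < ((8 * (d + 1) : ℕ) : ℝ) := by exact_mod_cast (by omega : k < 8 * (d + 1))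
        push_cast at this; linarith
      have hpos : (0 : ℝ) < 8 * ((d : ℝ) + 1) := by positivity
      rw [show (k : ℝ) * -(1 / (8 * ((d : ℝ) + 1))) = -((k : ℝ) / (8 * ((d : ℝ) + 1))) by ring]
      have : (k : ℝ) / (8 * ((d : ℝ) + 1)) < 1 := by rw [div_lt_one hpos]; exact hk8
      linarith
    refine hap.mono fun y y' => ?_
    rw [← hr]
    calc 4 * (C₀ * Real.exp δ₅) * Real.exp (-(δ₅ * tdistT (MP (paramsOf d L mT k hL')) y y')) ≤ 4 * (C₀ * Real.exp δ₅) * Real.exp (-(δ * tdistT (MP (paramsOf d L mT k hL')) y y')) :=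
          mul_le_mul_of_nonneg_left (Real.exp_le_exp.mpr (neg_le_neg (mul_le_mul_of_nonneg_right hδ5 (tdistT_nonneg _ y y')))) (by positivity)
      _ ≤ 4 * (C₀ * Real.exp δ₅) * ((L : ℝ) * r) * Real.exp (-(δ * tdistT (MP (paramsOf d L mT k hL')) y y')) := by
          have h0 : 0 ≤ 4 * (C₀ * Real.exp δ₅) * Real.exp (-(δ * tdistT (MP (paramsOf d L mT k hL')) y y')) := by positivity
          nlinarith
      _ = (4 * (C₀ * Real.exp δ₅) * L) * r * Real.exp (-(δ * tdistT (MP (paramsOf d L mT k hL')) y y')) := by ring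
      _ ≤ (Cbig + 1) * r * Real.exp (-(δ * tdistT (MP (paramsOf d L mT k hL')) y y')) := by
          refine mul_le_mul_of_nonneg_right (mul_le_mul_of_nonneg_right ?_ hr0) (hE y y')
          rw [hCbig]
          have : 0 ≤ C₂ + 2 * ((d : ℝ) + 1) * Real.exp δ ^ (d + 1) * (C₁ * (2 + Real.exp δ₅) * (L : ℝ) ^ (1 / 2 : ℝ)) := by positivity
          linarith

end Family

end Summit.QuantumFields.YangMills.BalabanUVNodes.N15.TwoGrid
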